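import Summits.CriticalPhenomena.PercolationContinuityZ3.Theorems.PercNearOneGluingNoHeavyLowerTailCornerRealizers
import Literature.Probability.Percolation.TripodExchange
import HarnessLib

/-!
# `NoHeavyLowerTail` (stmt-CriticalPhenomena-4575) — corner programme, layer 7:
# THE WORST-FIRST TELESCOPING SUM (WF) IS AT MOST ONE TO LEADING ORDER AT THE RELIABLE CORNER, for EVERY `|A|`

(WF) (k-cluster line; `(WF) ⇒ EG ⇒ crux` is the landed reduction p176711): rank the relays worst-first and split the
exit event `X = {o ↔ A} ∩ {o ↮ b}` by the FIRST relay of `C(o)`; then `Σ_a P(X, a first) / P(a ↮ b) ≤ 1`.  At the corner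
`w = 1 − ε·λ`, in the equal-order regime (every `{a ↮ b}` of order `≥ m`, `m` = the order of `X`), the leading-order
form reads: for every WORST-FIRST SELECTOR `φ` (to each order-`m` realizer `S` of `X` a relay `φ(S) ∈ C_o(S)` maximising
the coefficient `N_a = L_m({a ↮ b})` over the relays of `C_o(S)`),
        `Σ_{S ∈ R_m(X)} λ(S) / N_{φ(S)} ≤ 1`            (`Corner.weightedFirst_sum_le_one`).
Proof: the two-cover `R_m(X) = F_{t₁} ∪ F_{t₂}` of layer 3a (no three-antichain), the bound
`Σ ≤ λ(F_{t₁})/N₁ + λ(F_{t₂} ∖ F_{t₁})/N₂` for `N₁ ≥ N₂`, and the corner exchange `p₁p₂ ≤ q₁q₂`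
(`Corner.exit_exchange`: C⁺ = `Literature…tripodExchange` read at leading order, as in layer 3b), which with `N₁ ≥ N₂`
forces `p₁ ≤ q₁` and then `p₁N₁ ≤ q₁N₂`.  Census: kit j043080 WF_0 9.76 M contentful / 0 violations; j051514 104 805 / 0.
[folklore] bookkeeping + the landed C⁺; nothing about the crux is asserted (per-graph asymptotics, equal-order regime).
-/

noncomputable section

namespace Summit.CriticalPhenomena.PercolationContinuityZ3.Theorems

open MeasureTheory Filter Topology Finset
open Literature.Probability.LatticeModels Literature.Probability.Percolation

namespace Corner

open scoped Classical

variable {V : Type*} [Fintype V] [DecidableEq V]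

/-- **The corner exchange for two incomparable up-families.** With `pᵢ = λ(F_{t_{3−i}} ∖ F_{tᵢ})`-type differences and
`qᵢ = λ(R_m({tᵢ ↮ b}) ∖ F_{tᵢ})`:  `λ(F₂ ∖ F₁)·λ(F₁ ∖ F₂) ≤ q₁·q₂` (C⁺ at leading order; extracted from layer 3b's
`leading_exit_le`). [folklore] -/
theorem exit_exchange (E : Finset (Sym2 V)) (lam : Sym2 V → ℝ) (hlam : ∀ e ∈ E, 0 ≤ lam e) (o b : V) (m : ℕ)
    {t₁ t₂ : V}
    (hm₁ : ∀ T ∈ E.powerset, (↑T : Set (Sym2 V)) ∈ (openConn t₁ b)ᶜ → m ≤ (E \ T).card)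
    (hm₂ : ∀ T ∈ E.powerset, (↑T : Set (Sym2 V)) ∈ (openConn t₂ b)ᶜ → m ≤ (E \ T).card)
    (h₁₂ : ¬ upFam E m o b t₁ ⊆ upFam E m o b t₂) (h₂₁ : ¬ upFam E m o b t₂ ⊆ upFam E m o b t₁) :
    famWeight E lam (upFam E m o b t₂ \ upFam E m o b t₁) * famWeight E lam (upFam E m o b t₁ \ upFam E m o b t₂) ≤
      famWeight E lam (realizers E (openConn t₁ b)ᶜ m \ upFam E m o b t₁) *
        famWeight E lam (realizers E (openConn t₂ b)ᶜ m \ upFam E m o b t₂) := by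
  have hm1 : 1 ≤ m := by
    rcases Nat.eq_zero_or_pos m with h0 | hpos
    · exfalso
      subst h0
      obtain ⟨S, hS₁, hS₁'⟩ := Finset.not_subset.1 h₁₂
      obtain ⟨S', hS₂, hS₂'⟩ := Finset.not_subset.1 h₂₁
      rw [eq_of_mem_upFam_zero hS₁] at hS₁
      rw [eq_of_mem_upFam_zero hS₂] at hS₂'
      exact hS₂' hS₁
    · exact hpos
  set F₁ := upFam E m o b t₁
  set F₂ := upFam E m o b t₂
  set T₁ : Set (Set (Sym2 V)) := openConn o t₂ ∩ openConn t₁ b ∩ (openConn t₂ t₁)ᶜ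
  set T₂ : Set (Set (Sym2 V)) := openConn o t₁ ∩ openConn t₂ b ∩ (openConn t₂ t₁)ᶜ
  set T₃ : Set (Set (Sym2 V)) := openConn o t₂ ∩ openConn t₂ b ∩ (openConn t₂ t₁)ᶜ
  set T₄ : Set (Set (Sym2 V)) := openConn o t₁ ∩ openConn t₁ b ∩ (openConn t₂ t₁)ᶜ
  have swap : ∀ {S : Finset (Sym2 V)} {x y : V} {P : Set (Set (Sym2 V))},
      (↑S : Set (Sym2 V)) ∈ P ∩ (openConn x y)ᶜ → (↑S : Set (Sym2 V)) ∈ P ∩ (openConn y x)ᶜ := by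
    intro S x y P h
    simp only [Set.mem_inter_iff, Set.mem_compl_iff, openConn, Set.mem_setOf_eq] at h ⊢
    exact ⟨h.1, fun h' => h.2 h'.symm⟩
  have hp₁ : famWeight E lam (F₂ \ F₁) ≤ leading E lam T₁ m := by
    rw [leading_eq_famWeight]
    exact famWeight_mono hlam fun S hS =>
      mem_realizers_tripod_of_mem_sdiff hm1 hm₁ hm₂ (Finset.mem_sdiff.1 hS).1 (Finset.mem_sdiff.1 hS).2
  have hp₂ : famWeight E lam (F₁ \ F₂) ≤ leading E lam T₂ m := by
    rw [leading_eq_famWeight]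
    refine famWeight_mono hlam fun S hS => ?_
    obtain ⟨hSE, hT, hcard⟩ := mem_realizers.1
      (mem_realizers_tripod_of_mem_sdiff hm1 hm₂ hm₁ (Finset.mem_sdiff.1 hS).1 (Finset.mem_sdiff.1 hS).2)
    exact mem_realizers.2 ⟨hSE, swap hT, hcard⟩
  have hq₁ : leading E lam T₃ m ≤ famWeight E lam (realizers E (openConn t₁ b)ᶜ m \ F₁) := by
    rw [leading_eq_famWeight]; exact famWeight_mono hlam (realizers_tripod_subset_sdiff E m o b t₁ t₂)
  have hq₂ : leading E lam T₄ m ≤ famWeight E lam (realizers E (openConn t₂ b)ᶜ m \ F₂) := by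
    rw [leading_eq_famWeight]
    refine famWeight_mono hlam fun S hS => realizers_tripod_subset_sdiff E m o b t₂ t₁ ?_
    obtain ⟨hSE, hT, hcard⟩ := mem_realizers.1 hS
    exact mem_realizers.2 ⟨hSE, swap hT, hcard⟩
  have br : ∀ {D : Set (Set (Sym2 V))}, (∀ S ∈ E.powerset, (↑S : Set (Sym2 V)) ∈ D → m ≤ (E \ S).card) →
      ∀ S ∈ E.powerset, (↑S : Set (Sym2 V)) ∈ D →
        m ≤ (@SDiff.sdiff (Finset (Sym2 V)) (@Finset.instSDiff (Sym2 V) fun a b => Classical.propDecidable (a = b))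
          E S).card := by
    intro D h S hS hD
    have h' := h S hS hD
    convert h' using 2
    ext e; simp only [Finset.mem_sdiff]
  have hC : leading E lam T₁ m * leading E lam T₂ m ≤ leading E lam T₃ m * leading E lam T₄ m :=
    leading_mul_le_of_real_mul_le E lam hlam T₁ T₂ T₃ T₄ m (br (order_tripod_left (o := o) hm₂))
      (br fun S hS hD => order_tripod_left (o := o) hm₁ S hS (swap hD))
      (br (order_tripod_right (o := o) hm₁)) (br fun S hS hD => order_tripod_right (o := o) hm₂ S hS (swap hD))
      (Filter.Eventually.of_forall fun ε => tripodExchange (cornerWeight E lam ε) o t₂ t₁ b)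
  calc famWeight E lam (F₂ \ F₁) * famWeight E lam (F₁ \ F₂)
      ≤ leading E lam T₁ m * leading E lam T₂ m :=
        mul_le_mul hp₁ hp₂ (famWeight_nonneg hlam _) (leading_nonneg E lam hlam T₁ m)
    _ ≤ leading E lam T₃ m * leading E lam T₄ m := hC
    _ ≤ _ := mul_le_mul hq₁ hq₂ (leading_nonneg E lam hlam T₄ m) (famWeight_nonneg hlam _)

/-- **(WF) at the corner, coefficient form (every `|A|`, equal-order regime).** If every `{a ↮ b}` has order `≥ m`
and `λ > 0`, then for every worst-first selector `φ` on the order-`m` realizers of the exit event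
(`φ(S)` a relay of `C_o(S)` maximising `N_a = L_m({a ↮ b})` over the relays of `C_o(S)`),
`Σ_{S ∈ R_m(X)} λ(S) / N_{φ(S)} ≤ 1`. [folklore] (new here) -/
theorem weightedFirst_sum_le_one (E : Finset (Sym2 V)) (lam : Sym2 V → ℝ) (hlam : ∀ e ∈ E, 0 < lam e)
    (A : Finset V) (o b : V) (m : ℕ)
    (hm : ∀ a ∈ A, ∀ T ∈ E.powerset, (↑T : Set (Sym2 V)) ∈ (openConn a b)ᶜ → m ≤ (E \ T).card)
    (φ : Finset (Sym2 V) → V)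
    (hφ : ∀ S ∈ realizers E (exitEvent A o b) m, φ S ∈ A ∧ φ S ∈ clus (↑S : Set (Sym2 V)) o ∧
      ∀ a ∈ A, a ∈ clus (↑S : Set (Sym2 V)) o →
        leading E lam (openConn a b)ᶜ m ≤ leading E lam (openConn (φ S) b)ᶜ m) :
    ∑ S ∈ realizers E (exitEvent A o b) m, (∏ e ∈ E \ S, lam e) / leading E lam (openConn (φ S) b)ᶜ m ≤ 1 := by
  have hlam' : ∀ e ∈ E, 0 ≤ lam e := fun e he => (hlam e he).le
  set R := realizers E (exitEvent A o b) m with hR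
  set N : V → ℝ := fun a => leading E lam (openConn a b)ᶜ m with hN
  -- weights and the basic comparison  λ(S) ≤ famWeight F_a ≤ N_a  for a ∈ C_o(S)
  have wpos : ∀ S ∈ R, 0 < ∏ e ∈ E \ S, lam e :=
    fun S _ => Finset.prod_pos fun e he => hlam e (Finset.mem_sdiff.1 he).1
  have memF : ∀ S ∈ R, ∀ a, a ∈ clus (↑S : Set (Sym2 V)) o → S ∈ upFam E m o b a := by
    intro S hS a ha
    obtain ⟨a', -, hSa'⟩ := mem_realizers_exit_iff.1 hS
    exact (mem_upFam_iff_mem_clus hSa').2 ha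
  have FleN : ∀ a, famWeight E lam (upFam E m o b a) ≤ N a := fun a => by
    show famWeight E lam (upFam E m o b a) ≤ leading E lam (openConn a b)ᶜ m
    rw [leading_eq_famWeight]; exact famWeight_mono hlam' (upFam_subset E m o b a)
  have wleF : ∀ S ∈ R, ∀ a, a ∈ clus (↑S : Set (Sym2 V)) o → (∏ e ∈ E \ S, lam e) ≤ famWeight E lam (upFam E m o b a) :=
    fun S hS a ha => Finset.single_le_sum (f := fun S : Finset (Sym2 V) => ∏ e ∈ E \ S, lam e)
      (fun S' hS' => (famWeight_nonneg hlam' ({S'} : Finset (Finset (Sym2 V)))).trans_eq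
        (Finset.sum_singleton _ _)) (memF S hS a ha)
  have Npos : ∀ S ∈ R, ∀ a, a ∈ clus (↑S : Set (Sym2 V)) o → 0 < N a :=
    fun S hS a ha => lt_of_lt_of_le (lt_of_lt_of_le (wpos S hS) (wleF S hS a ha)) (FleN a)
  -- empty family
  by_cases hA : A.Nonempty
  swap
  · rw [Finset.not_nonempty_iff_eq_empty] at hA
    have hR0 : R = ∅ := by
      rw [Finset.eq_empty_iff_forall_notMem]
      intro S hS
      obtain ⟨a, ha, -⟩ := mem_realizers_exit_iff.1 hS
      rw [hA] at ha; exact Finset.notMem_empty a ha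
    rw [hR0, Finset.sum_empty]; exact zero_le_one
  -- the two-cover
  obtain ⟨t₁, ht₁, t₂, ht₂, hcov⟩ := exists_two_cover A (upFam E m o b) hA
    (fun t₁ h₁ t₂ h₂ t₃ h₃ => upFam_no_three_antichain E m o b (hm t₁ h₁) (hm t₂ h₂) (hm t₃ h₃))
  -- KEY: if R = F_u ∪ F_v with N v ≤ N u then the sum is ≤ 1
  have key : ∀ u ∈ A, ∀ v ∈ A, R = upFam E m o b u ∪ upFam E m o b v → N v ≤ N u →
      ∑ S ∈ R, (∏ e ∈ E \ S, lam e) / N (φ S) ≤ 1 := by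
    intro u hu v hv hRuv hNvu
    set Fu := upFam E m o b u
    set Fv := upFam E m o b v
    -- termwise bounds
    have bu : ∀ S ∈ Fu, (∏ e ∈ E \ S, lam e) / N (φ S) ≤ (∏ e ∈ E \ S, lam e) / N u := by
      intro S hS
      have hSR : S ∈ R := by rw [hRuv]; exact Finset.mem_union_left _ hS
      have huC : u ∈ clus (↑S : Set (Sym2 V)) o := (mem_upFam_iff_mem_clus hS).1 hS
      exact div_le_div_of_nonneg_left (wpos S hSR).le (Npos S hSR u huC) ((hφ S hSR).2.2 u hu huC)
    have bv : ∀ S ∈ Fv \ Fu, (∏ e ∈ E \ S, lam e) / N (φ S) ≤ (∏ e ∈ E \ S, lam e) / N v := by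
      intro S hS
      have hS' := (Finset.mem_sdiff.1 hS).1
      have hSR : S ∈ R := by rw [hRuv]; exact Finset.mem_union_right _ hS'
      have hvC : v ∈ clus (↑S : Set (Sym2 V)) o := (mem_upFam_iff_mem_clus hS').1 hS'
      exact div_le_div_of_nonneg_left (wpos S hSR).le (Npos S hSR v hvC) ((hφ S hSR).2.2 v hv hvC)
    have hsplit : R = Fu ∪ (Fv \ Fu) := by rw [hRuv, Finset.union_sdiff_self_eq_union]
    have hdisj : Disjoint Fu (Fv \ Fu) := Finset.disjoint_sdiff
    rw [hsplit, Finset.sum_union hdisj]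
    have s1 : ∑ S ∈ Fu, (∏ e ∈ E \ S, lam e) / N (φ S) ≤ famWeight E lam Fu / N u := by
      rw [famWeight, Finset.sum_div]; exact Finset.sum_le_sum bu
    have s2 : ∑ S ∈ Fv \ Fu, (∏ e ∈ E \ S, lam e) / N (φ S) ≤ famWeight E lam (Fv \ Fu) / N v := by
      rw [famWeight, Finset.sum_div]; exact Finset.sum_le_sum bv
    refine (add_le_add s1 s2).trans ?_
    -- case F_v \ F_u = ∅ : the sum is λ(F_u)/N_u ≤ 1
    by_cases hvu : Fv ⊆ Fu
    · have h0 : famWeight E lam (Fv \ Fu) = 0 := by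
        rw [Finset.sdiff_eq_empty_iff_subset.2 hvu]; simp [famWeight]
      rw [h0, zero_div, add_zero]
      by_cases hFu : Fu.Nonempty
      · obtain ⟨S, hS⟩ := hFu
        have hSR : S ∈ R := by rw [hRuv]; exact Finset.mem_union_left _ hS
        exact (div_le_one (Npos S hSR u ((mem_upFam_iff_mem_clus hS).1 hS))).2 (FleN u)
      · rw [Finset.not_nonempty_iff_eq_empty.1 hFu]; simp [famWeight]
    by_cases huv : Fu ⊆ Fv
    · -- then every S ∈ R lies in F_v, so N(φ S) ≥ N v... but we bounded F_u-terms by N_u ≥ N_v: fine since N_v ≤ N_u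
      -- use instead: λ(F_u)/N_u + λ(F_v \ F_u)/N_v ≤ λ(F_u)/N_v + λ(F_v \ F_u)/N_v = λ(F_v)/N_v ≤ 1
      obtain ⟨S, hS, -⟩ := Finset.not_subset.1 hvu
      have hSR : S ∈ R := by rw [hRuv]; exact Finset.mem_union_right _ hS
      have hNv : 0 < N v := Npos S hSR v ((mem_upFam_iff_mem_clus hS).1 hS)
      have h1 : famWeight E lam Fu / N u ≤ famWeight E lam Fu / N v :=
        div_le_div_of_nonneg_left (famWeight_nonneg hlam' _) hNv hNvu
      refine (add_le_add h1 le_rfl).trans ?_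
      rw [← add_div, ← famWeight_union_eq, Finset.union_eq_right.2 huv]
      exact (div_le_one hNv).2 (FleN v)
    -- incomparable: the exchange
    obtain ⟨S₀, hS₀, -⟩ := Finset.not_subset.1 hvu
    have hS₀R : S₀ ∈ R := by rw [hRuv]; exact Finset.mem_union_right _ hS₀
    have hNv : 0 < N v := Npos S₀ hS₀R v ((mem_upFam_iff_mem_clus hS₀).1 hS₀)
    have hNu : 0 < N u := lt_of_lt_of_le hNv hNvu
    have hex := exit_exchange E lam hlam' o b m (hm u hu) (hm v hv) huv hvu
    set p := famWeight E lam (Fv \ Fu) with hp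
    set p' := famWeight E lam (Fu \ Fv) with hp'
    set qu := famWeight E lam (realizers E (openConn u b)ᶜ m \ Fu) with hqu
    set qv := famWeight E lam (realizers E (openConn v b)ᶜ m \ Fv) with hqv
    set c := famWeight E lam (Fu ∩ Fv) with hc
    have hNu_eq : N u = famWeight E lam Fu + qu := by
      show leading E lam (openConn u b)ᶜ m = _
      rw [leading_eq_famWeight]; exact famWeight_eq_add_sdiff (upFam_subset E m o b u)
    have hNv_eq : N v = famWeight E lam Fv + qv := by
      show leading E lam (openConn v b)ᶜ m = _
      rw [leading_eq_famWeight]; exact famWeight_eq_add_sdiff (upFam_subset E m o b v)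
    have hFu_eq : famWeight E lam Fu = c + p' := by
      rw [hc, hp', famWeight, famWeight, famWeight, ← Finset.sum_inter_add_sum_sdiff Fu Fv]
    have hFv_eq : famWeight E lam Fv = c + p := by
      rw [hc, hp, famWeight, famWeight, famWeight, Finset.inter_comm, ← Finset.sum_inter_add_sum_sdiff Fv Fu]
    have hp0 : 0 ≤ p := famWeight_nonneg hlam' _
    have hp'0 : 0 ≤ p' := famWeight_nonneg hlam' _
    have hqu0 : 0 ≤ qu := famWeight_nonneg hlam' _
    have hqv0 : 0 ≤ qv := famWeight_nonneg hlam' _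
    have hc0 : 0 ≤ c := famWeight_nonneg hlam' _
    -- p ≤ qu (else p' ≤ qv by the exchange and then N u < N v)
    have hpqu : p ≤ qu := by
      by_contra hlt
      rw [not_le] at hlt
      have hp'qv : p' ≤ qv := by
        by_contra hlt'
        rw [not_le] at hlt'
        exact absurd hex (not_le.2 (mul_lt_mul'' hlt hlt' hqu0 hqv0))
      have : N u < N v := by rw [hNu_eq, hNv_eq, hFu_eq, hFv_eq]; linarith
      exact absurd hNvu (not_le.2 this)
    rw [div_add_div _ _ hNu.ne' hNv.ne', div_le_one (mul_pos hNu hNv), hNu_eq, hNv_eq, hFu_eq, hFv_eq]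
    nlinarith [mul_le_mul_of_nonneg_right hpqu hc0, hex, mul_nonneg hp0 hqu0]
  -- apply KEY to the cover, ordered by N
  have hRcov : R = upFam E m o b t₁ ∪ upFam E m o b t₂ := by
    ext S
    rw [mem_realizers_exit_iff, Finset.mem_union]
    constructor
    · rintro ⟨a, ha, hS⟩
      rcases hcov a ha with h | h
      · exact Or.inl (h hS)
      · exact Or.inr (h hS)
    · rintro (h | h)
      · exact ⟨t₁, ht₁, h⟩
      · exact ⟨t₂, ht₂, h⟩
  rcases le_total (N t₂) (N t₁) with h | h
  · exact key t₁ ht₁ t₂ ht₂ hRcov h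
  · exact key t₂ ht₂ t₁ ht₁ (by rw [hRcov, Finset.union_comm]) h

end Corner

end Summit.CriticalPhenomena.PercolationContinuityZ3.Theorems

end
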